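import Summits.HubbardSuperconductivity.HubbardSuperconductivity.Theorems.WidthHaldaneTubePairSteps

/-!
# `η`-lowest weight: strict pair convexity forces `η ψ = 0` on every sector ground state

Crux `WidthHaldaneBridge` (stmt-HubbardSuperconductivity-16311) and its sibling
`WidthUniformThermodynamics` (stmt-16312) carry in their hypothesis `UniformThermo` the STRICT
pair-convexity clause `0 < ẽ″_{L,M} = LM[E(N+2) + E(N-2) - 2E(N)]/4` (`Theorems/WidthHaldaneDefs`).
Crux idea `eta-lowest-weight` (2026-08-17 round, card `Cruxes/WidthHaldaneBridge/Ideas/`) observes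
that in the PURE Hubbard model this clause has exact algebraic teeth: by Yang's commutator
`[H₀, η†_ε] = U η†_ε` on the bipartite (even) tube, `η†ψ` and `ηψ` are EXACT eigenvectors at
`E ± U` in the sectors `N ± 2`; `η†ψ ≠ 0` below half filling, so a ground state with `ηψ ≠ 0`
would give `E(N+2) + E(N-2) - 2E(N) ≤ (E + U) + (E - U) - 2E = 0`. Hence under `0 < ẽ″` EVERY
sector ground state at the cruxes' filling is an `η`-LOWEST-WEIGHT vector, `η_ε ψ = 0`
(pseudospin `J = |J^z|`): a linear constraint on whole (possibly degenerate) ground spaces, free to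
assume inside every stub of every line of the crux, and a vacuity map for stmt-16312 (wherever a
sector ground state has `ηψ ≠ 0`, `ẽ″ ≤ 0`).

This file PROVES it (no definition, no named fact), completing the `η†` half landed in
`Theorems/WidthHaldaneTubeEtaPairing.lean` (`minEnergyOn_szSector_add_two_le`) by the `η` half:

* `totalNumber_mul_etaLower`, `etaLower_commute_spinZ`, `etaLower_mulVec_apply_eq_zero`,
  `etaLower_mulVec_mem_szSector` — `η` lowers `N` by two and preserves `S^z`
  (conjugate transposes of the landed `η†` relations);
* `mul_etaLower_of_commutator_etaRaise` — `H η = η H - U η` for Hermitian `H` with Yang's commutator;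
* `minEnergyOn_szSector_le_sub_of_etaLower_ne_zero` — GENERIC: if a sector ground state `ψ` of
  `(N+2, S^z)` has `ηψ ≠ 0` then `E_H(N, S^z) ≤ E_H(N+2, S^z) - U`;
* **`etaLower_mulVec_eq_zero_of_pairConvex`** — GENERIC MAIN: strict convexity
  `2E_H(N+2) < E_H(N+4) + E_H(N)` at `N + 2 < |Λ|` forces `ηψ = 0` for every ground state of
  `(N+2, S^z)`;
* `ite_stagger_bipartite` — the explicit stagger `(-1)^{a+b}` (as `if (a+b) % 2 = 0 then 1 else -1`)
  is bipartite on even tubes;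
* **`etaLower_groundState_eq_zero`** — TUBE MAIN: `δ > 0`, any bipartite sign `ε` (`L`, `M` even),
  `0 < ẽ″_{L,M}(U,δ)` ⇒ `η_ε ψ = 0` for every `(N_{L,M}(δ), S^z = 0)` sector ground state of `tubeH0`;
  `uniformThermo_etaLowestWeight` — the same under `UniformThermo` at every admissible size;
  `etaLowestWeight` — closed form with the explicit stagger (the registered sub-goal).

References: C. N. Yang, PRL 63 (1989) 2144, eqs. (4)–(6); C. N. Yang, S. C. Zhang, Mod. Phys. Lett.
B 4 (1990) 759, Theorem 1; S.-C. Zhang, PRL 65 (1990) 120 (pseudospin multiplets); H. Tasaki,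
*Physics and Mathematics of Quantum Many-Body Systems* (2020) §2.2 (variational principle in an
invariant sector).
-/

noncomputable section

namespace Summit.HubbardSuperconductivity.HubbardSuperconductivity.Theorems.WidthHaldane

set_option linter.dupNamespace false -- summit = problem name (single-conjunct summit), D-0017

open scoped BigOperators Classical Matrix ComplexConjugate ComplexOrder
open Matrix Literature.MathematicalPhysics.QuantumLattice

/-! ### Generic: `η` on the joint sectors and the pair-removal bound -/

section Generic

variable {Λ : Type*} [LinearOrder Λ] [Fintype Λ]

/-- **`[N̂, η] = -2η`**: `N̂ η_ε = η_ε N̂ - 2 η_ε` (conjugate transpose of `[N̂, η†] = 2η†`,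
`totalNumber_commutator_etaRaise_holds`; `N̂` is the real diagonal `|s|·δ_{st}`, hence Hermitian).
Yang, PRL 63 (1989) 2144. [cite: Yang1989, eq. (4)] -/
theorem totalNumber_mul_etaLower (ε : Λ → ℤˣ) :
    (totalNumber : Matrix (Finset (Orb Λ)) (Finset (Orb Λ)) ℂ) * etaLower ε =
      etaLower ε * totalNumber - (2 : ℂ) • etaLower ε := by
  have hN : (totalNumber : Matrix (Finset (Orb Λ)) (Finset (Orb Λ)) ℂ)ᴴ = totalNumber := by
    rw [← totalNumberOp_eq_totalNumber, totalNumberOp_eq_diagonal, diagonal_conjTranspose]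
    congr 1
    funext s
    simp
  have h := congr_arg conjTranspose (totalNumber_commutator_etaRaise_holds (Λ := Λ) ε)
  rw [conjTranspose_sub, conjTranspose_mul, conjTranspose_mul, conjTranspose_smul, hN,
    star_ofNat] at h
  change etaLower ε * totalNumber - totalNumber * etaLower ε = (2 : ℂ) • etaLower ε at h
  rw [← h]
  abel

/-- **`η` commutes with `S^z`** (conjugate transpose of `etaRaise_commute_spinZ`). Yang–Zhang,
Mod. Phys. Lett. B 4 (1990) 759, Theorem 2. [cite: YangZhang1990, Theorem 2] -/
theorem etaLower_commute_spinZ (ε : Λ → ℤˣ) :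
    Commute (etaLower ε) (HubbardWave0.spinZ : Matrix (Finset (Orb Λ)) (Finset (Orb Λ)) ℂ) := by
  have h := congr_arg conjTranspose (etaRaise_commute_spinZ (Λ := Λ) ε).eq
  rw [conjTranspose_mul, conjTranspose_mul, LiebTwo.spinZ_conjTranspose] at h
  exact h.symm

/-- **`η` lowers the particle number by two**: on an `N`-particle vector `ψ`, `(η_ε ψ)(s) = 0`
unless `|s| + 2 = N` (evaluate `N̂ η = η N̂ - 2η` at the configuration `s`). Yang, PRL 63 (1989)
2144. [cite: Yang1989, eq. (4)] -/
theorem etaLower_mulVec_apply_eq_zero (ε : Λ → ℤˣ) {N : ℕ} {ψ : Fock (Orb Λ)} (hψ : IsNParticle N ψ)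
    (s : Finset (Orb Λ)) (hs : s.card + 2 ≠ N) : (etaLower ε *ᵥ ψ) s = 0 := by
  have hv := congr_fun (congr_arg (fun A : Matrix (Finset (Orb Λ)) (Finset (Orb Λ)) ℂ => A *ᵥ ψ)
    (totalNumber_mul_etaLower (Λ := Λ) ε)) s
  rw [← mulVec_mulVec, totalNumber_mulVec_apply, sub_mulVec, ← mulVec_mulVec,
    totalNumber_mulVec_of_isNParticle hψ, mulVec_smul, smul_mulVec, Pi.sub_apply, Pi.smul_apply,
    Pi.smul_apply, smul_eq_mul, smul_eq_mul] at hv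
  -- hv : |s|·(ηψ)(s) = N·(ηψ)(s) - 2·(ηψ)(s)
  have hne : ((s.card : ℂ) - N + 2) ≠ 0 := by
    intro h0
    apply hs
    have h1 : ((s.card + 2 : ℕ) : ℂ) = (N : ℂ) := by
      push_cast
      linear_combination h0
    exact_mod_cast h1
  have hprod : ((s.card : ℂ) - N + 2) * (etaLower ε *ᵥ ψ) s = 0 := by linear_combination hv
  exact (mul_eq_zero.1 hprod).resolve_left hne

/-- **`η` maps the sector `(N+2, S^z)` into `(N, S^z)`**. Yang–Zhang, Mod. Phys. Lett. B 4 (1990)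
759, Theorem 1. [cite: YangZhang1990, Theorem 1] -/
theorem etaLower_mulVec_mem_szSector (ε : Λ → ℤˣ) {N : ℕ} {Sz : ℝ} {ψ : Fock (Orb Λ)}
    (hψ : ψ ∈ szSector (N + 2) Sz) : etaLower ε *ᵥ ψ ∈ szSector N Sz := by
  rw [mem_szSector_iff] at hψ ⊢
  obtain ⟨hN, hS⟩ := hψ
  refine ⟨fun s hs => etaLower_mulVec_apply_eq_zero ε hN s (by omega), ?_⟩
  rw [mulVec_mulVec, ← (etaLower_commute_spinZ (Λ := Λ) ε).eq, ← mulVec_mulVec, hS, mulVec_smul]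

/-- On an `N`-particle vector with `N < 2` the lowering operator vanishes: `η_ε ψ = 0`. [folklore] -/
theorem etaLower_mulVec_eq_zero_of_lt_two (ε : Λ → ℤˣ) {N : ℕ} {ψ : Fock (Orb Λ)}
    (hψ : IsNParticle N ψ) (hN : N < 2) : etaLower ε *ᵥ ψ = 0 :=
  funext fun s => etaLower_mulVec_apply_eq_zero ε hψ s (by omega)

/-- **`H η = η H - U η`** for a Hermitian `H` with Yang's commutator `[H, η†_ε] = U η†_ε` (`U` real):
the conjugate-transposed commutator. Yang, PRL 63 (1989) 2144, eq. (6). [cite: Yang1989, eq. (6)] -/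
theorem mul_etaLower_of_commutator_etaRaise {H : Matrix (Finset (Orb Λ)) (Finset (Orb Λ)) ℂ}
    (hH : H.IsHermitian) (ε : Λ → ℤˣ) {U : ℝ}
    (hc : H * etaRaise ε - etaRaise ε * H = (U : ℂ) • etaRaise ε) :
    H * etaLower ε = etaLower ε * H - (U : ℂ) • etaLower ε := by
  have h := congr_arg conjTranspose hc
  rw [conjTranspose_sub, conjTranspose_mul, conjTranspose_mul, conjTranspose_smul, hH.eq,
    Complex.star_def, Complex.conj_ofReal] at h
  change etaLower ε * H - H * etaLower ε = (U : ℂ) • etaLower ε at h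
  rw [← h]
  abel

/-- **Pair REMOVAL costs at least `U` when it is possible (generic form).** Let `H` be Hermitian on
`Fock (Orb Λ)` with `[H, η†_ε] = U η†_ε`, and let `ψ` be a ground state of `H` in the sector
`(N+2, S^z)` with `η_ε ψ ≠ 0`. Then `η_ε ψ` is a nonzero `(E - U)`-eigenvector in the sector
`(N, S^z)`, so `E_H(N, S^z) ≤ E_H(N+2, S^z) - U`. Yang, PRL 63 (1989) 2144, eq. (6); Tasaki (2020)
§2.2. [cite: Yang1989, eq. (6)] -/
theorem minEnergyOn_szSector_le_sub_of_etaLower_ne_zero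
    {H : Matrix (Finset (Orb Λ)) (Finset (Orb Λ)) ℂ} (hH : H.IsHermitian) (ε : Λ → ℤˣ) {U : ℝ}
    (hc : H * etaRaise ε - etaRaise ε * H = (U : ℂ) • etaRaise ε) {N : ℕ} {Sz : ℝ}
    {ψ : Fock (Orb Λ)} (hgs : IsGroundStateInSector H (N + 2) Sz ψ) (hne : etaLower ε *ᵥ ψ ≠ 0) :
    H.minEnergyOn (szSector N Sz) ≤ H.minEnergyOn (szSector (N + 2) Sz) - U := by
  obtain ⟨hmem, -, hHψ⟩ := hgs
  have hφmem : etaLower ε *ᵥ ψ ∈ szSector N Sz := etaLower_mulVec_mem_szSector ε hmem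
  set E := H.minEnergyOn (szSector (N + 2) Sz) with hE
  have hHφ : H *ᵥ (etaLower ε *ᵥ ψ) = (((E - U : ℝ)) : ℂ) • (etaLower ε *ᵥ ψ) := by
    rw [mulVec_mulVec, mul_etaLower_of_commutator_etaRaise hH ε hc, sub_mulVec, smul_mulVec,
      ← mulVec_mulVec, hHψ, mulVec_smul, ← sub_smul]
    push_cast
    rfl
  obtain ⟨c, -, hc1⟩ := exists_smul_unit hne
  have hle := minEnergyOn_le_rayleigh_of_mem hH (szSector N Sz) (Submodule.smul_mem _ c hφmem) hc1
  rw [mulVec_smul, hHφ, smul_comm, dotProduct_smul, hc1, smul_eq_mul, mul_one,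
    Complex.ofReal_re] at hle
  exact hle

/-- **MAIN (generic): strict pair convexity forces `η`-lowest weight.** Let `H` be Hermitian on
`Fock (Orb Λ)` with Yang's commutator `[H, η†_ε] = U η†_ε`, and suppose the sector energies are
STRICTLY convex at `N + 2 < |Λ|`: `2E_H(N+2, S^z) < E_H(N+4, S^z) + E_H(N, S^z)`. Then every ground
state `ψ` of the sector `(N+2, S^z)` satisfies `η_ε ψ = 0` (otherwise `E(N+4) ≤ E(N+2) + U` by `η†`
and `E(N) ≤ E(N+2) - U` by `η` add up to non-strict concavity). Yang, PRL 63 (1989) 2144, eq. (6);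
Yang–Zhang (1990) Theorem 1; S.-C. Zhang, PRL 65 (1990) 120. [cite: Yang1989, eq. (6)] -/
theorem etaLower_mulVec_eq_zero_of_pairConvex
    {H : Matrix (Finset (Orb Λ)) (Finset (Orb Λ)) ℂ} (hH : H.IsHermitian) (ε : Λ → ℤˣ) {U : ℝ}
    (hc : H * etaRaise ε - etaRaise ε * H = (U : ℂ) • etaRaise ε) {N : ℕ} {Sz : ℝ}
    {ψ : Fock (Orb Λ)} (hgs : IsGroundStateInSector H (N + 2) Sz ψ) (hlt : N + 2 < Fintype.card Λ)
    (hconv : 2 * H.minEnergyOn (szSector (N + 2) Sz) <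
      H.minEnergyOn (szSector (N + 4) Sz) + H.minEnergyOn (szSector N Sz)) :
    etaLower ε *ᵥ ψ = 0 := by
  by_contra hne
  have h1 := minEnergyOn_szSector_le_sub_of_etaLower_ne_zero hH ε hc hgs hne
  have h2 := minEnergyOn_szSector_add_two_le hH ε hc hgs hlt
  have h4 : N + 2 + 2 = N + 4 := rfl
  rw [h4] at h2
  linarith

end Generic

/-! ### The even tubes: `0 < ẽ″` forces `η ψ = 0` on every sector ground state -/

section Tube

variable (L M : ℕ) [NeZero L] [NeZero M] (Λ : Type) [LinearOrder Λ] [Fintype Λ]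
  (e : Λ ≃ ZMod L × ZMod M)

omit [LinearOrder Λ] [Fintype Λ] in
/-- **The explicit stagger is bipartite on even tubes**: for `L`, `M` even, the sign
`x ↦ +1` if `a + b` is even, `-1` if odd (`e x = (a, b)`, representatives in `[0,L) × [0,M)`; the
witness of `exists_bipartite_sign`) flips across every bond of `tubeGraph e` — consistent around both
cycles exactly because both circumferences are even. Essler et al., *The One-Dimensional Hubbard
Model* (2005) §2.2.5. [cite: EsslerEtAl2005, §2.2.5] -/
theorem ite_stagger_bipartite (hL : Even L) (hM : Even M) :
    ∀ x y, (tubeGraph e).Adj x y →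
      (fun z : Λ => if ((e z).1.val + (e z).2.val) % 2 = 0 then (1 : ℤˣ) else -1) x =
        -(fun z : Λ => if ((e z).1.val + (e z).2.val) % 2 = 0 then (1 : ℤˣ) else -1) y := by
  intro x y hxy
  have key : ((e y).1.val + (e y).2.val) % 2 = ((e x).1.val + (e x).2.val + 1) % 2 := by
    obtain ⟨⟨a, b⟩, rfl⟩ := e.symm.surjective x
    obtain ⟨⟨a', b'⟩, rfl⟩ := e.symm.surjective y
    simp only [Equiv.apply_symm_apply, EmbeddingLike.apply_eq_iff_eq, SimpleGraph.fromRel_adj,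
      tubeGraph, ne_eq, Prod.mk.injEq] at hxy ⊢
    have hLa := val_add_one_mod_two hL a
    have hLa' := val_add_one_mod_two hL a'
    have hMb := val_add_one_mod_two hM b
    have hMb' := val_add_one_mod_two hM b'
    rcases hxy.2 with (⟨h1, h2⟩ | ⟨h1, h2⟩) | (⟨h1, h2⟩ | ⟨h1, h2⟩)
    · subst h1; subst h2; omega
    · subst h1; subst h2; omega
    · subst h1; subst h2; omega
    · subst h1; subst h2; omega
  dsimp only
  by_cases hx : ((e x).1.val + (e x).2.val) % 2 = 0
  · have hy : ¬ ((e y).1.val + (e y).2.val) % 2 = 0 := by omega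
    rw [if_pos hx, if_neg hy, neg_neg]
  · have hy : ((e y).1.val + (e y).2.val) % 2 = 0 := by omega
    rw [if_neg hx, if_pos hy]

/-- **TUBE MAIN — `0 < ẽ″` forces `η ψ = 0`.** On the pure Hubbard tube `ℤ/L × ℤ/M`, for every
`U`, every `δ > 0`, every labelling and every bipartite sign `ε` of `tubeGraph e` (one exists iff
`L`, `M` are even, `exists_bipartite_sign`):
if the inverse pair compressibility at the cruxes' filling is strictly positive,
`0 < ẽ″_{L,M}(U, δ)`, then every ground state `ψ` of `tubeH0` in the sector `(N_{L,M}(δ), S^z = 0)`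
is `η`-lowest-weight, `η_ε ψ = 0`. (The degenerate size `N_{L,M}(δ) = 0` is covered trivially: `η`
annihilates the vacuum sector.) Yang, PRL 63 (1989) 2144; S.-C. Zhang, PRL 65 (1990) 120.
[cite: Yang1989, eq. (6)] -/
theorem etaLower_groundState_eq_zero (ε : Λ → ℤˣ)
    (hε : ∀ x y, (tubeGraph e).Adj x y → ε x = -ε y) (U : ℝ) {δ : ℝ} (hδ : 0 < δ)
    (hpos : 0 < tubePairCompressibility L M Λ e U δ) {ψ : Fock (Orb Λ)}
    (hgs : IsGroundStateInSector (tubeH0 L M Λ e U) (tubeFilling L M δ) 0 ψ) :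
    etaLower ε *ᵥ ψ = 0 := by
  have hLM : 0 < L * M := Nat.pos_of_ne_zero (mul_ne_zero (NeZero.ne L) (NeZero.ne M))
  have hlt := tubeFilling_lt L M hLM hδ
  have hcard : Fintype.card Λ = L * M := card_carrier L M Λ e
  rw [tubePairCompressibility_eq, tubeEnergy_zero, tubeEnergy_zero, tubeEnergy_zero] at hpos
  unfold tubeFilling at hgs hpos hlt
  rcases Nat.eq_zero_or_pos ⌊(1 - δ) * ((L : ℝ) * (M : ℝ)) / 2⌋₊ with h0 | hnpos
  · -- empty sector: `η` lowers the particle number, so `ηψ = 0`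
    rw [h0, mul_zero] at hgs
    have hNpart : IsNParticle 0 ψ := ((mem_szSector_iff 0 0 ψ).1 hgs.1).1
    exact etaLower_mulVec_eq_zero_of_lt_two ε hNpart (by omega)
  · obtain ⟨j, hj⟩ : ∃ j, ⌊(1 - δ) * ((L : ℝ) * (M : ℝ)) / 2⌋₊ = j + 1 :=
      ⟨_, (Nat.succ_pred_eq_of_pos hnpos).symm⟩
    rw [hj] at hgs hpos hlt
    have h2 : 2 * (j + 1) = 2 * j + 2 := by ring
    have h3 : 2 * j + 2 - 2 = 2 * j := by omega
    have h4 : 2 * j + 2 + 2 = 2 * j + 4 := by ring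
    rw [h2] at hgs hpos hlt
    rw [h3, h4] at hpos
    refine etaLower_mulVec_eq_zero_of_pairConvex (isHermitian_tubeH0 L M Λ e U) ε
      (tubeH0_commutator_etaRaise L M Λ e ε hε U) hgs (by omega) ?_
    -- strict convexity from `0 < LM·(E(N+2) + E(N-2) - 2E(N))/4`
    have hLMr : (0 : ℝ) < (L : ℝ) * (M : ℝ) := by exact_mod_cast hLM
    by_contra hcv
    push Not at hcv
    have : (L : ℝ) * (M : ℝ) *
        ((tubeH0 L M Λ e U).minEnergyOn (szSector (2 * j + 4) 0) +
          (tubeH0 L M Λ e U).minEnergyOn (szSector (2 * j) 0) -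
            2 * (tubeH0 L M Λ e U).minEnergyOn (szSector (2 * j + 2) 0)) / 4 ≤ 0 :=
      div_nonpos_of_nonpos_of_nonneg (mul_nonpos_of_nonneg_of_nonpos hLMr.le (by linarith))
        (by norm_num)
    linarith

/-- **Under the cruxes' hypothesis.** If `UniformThermo U δ d₀ k₀ M₁ L₀` holds with `δ > 0`, then at
every admissible size (`L`, `M` even, `M₁ ≤ M ≤ L`, `L₀ ≤ L`), for every labelling and every
bipartite sign `ε`, every `(N_{L,M}(δ), S^z = 0)` sector ground state `ψ` of the pure tube obeys
`η_ε ψ = 0` — the clause `0 < ẽ″` is not inert. [cite: Yang1989, eq. (6)] -/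
theorem uniformThermo_etaLowestWeight {U δ d₀ k₀ : ℝ} {M₁ L₀ : ℕ} (hδ : 0 < δ)
    (h : UniformThermo U δ d₀ k₀ M₁ L₀) (hLe : Even L) (hMe : Even M) (hM₁ : M₁ ≤ M) (hML : M ≤ L)
    (hL₀ : L₀ ≤ L) (ε : Λ → ℤˣ) (hε : ∀ x y, (tubeGraph e).Adj x y → ε x = -ε y)
    {ψ : Fock (Orb Λ)} (hgs : IsGroundStateInSector (tubeH0 L M Λ e U) (tubeFilling L M δ) 0 ψ) :
    etaLower ε *ᵥ ψ = 0 :=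
  etaLower_groundState_eq_zero L M Λ e ε hε U hδ (h L M hLe hMe hM₁ hML hL₀ Λ e).2.1 hgs

end Tube

/-- **`η`-LOWEST WEIGHT, closed form** (all binders universally quantified; the registered sub-goal
`etaLowestWeight` of crux stmt-HubbardSuperconductivity-16311; the explicit stagger `ε = (-1)^{a+b}`
written as `if (a + b) % 2 = 0 then 1 else -1`, the witness of `exists_bipartite_sign`; the idea
card's hypotheses `δ < 1`, `2 ≤ N_{L,M}(δ)` are not needed): for `L`, `M` even, every labelling,
every `U`, every `δ > 0` with `0 < ẽ″_{L,M}(U,δ)`, every `(N_{L,M}(δ), S^z = 0)` sector ground state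
`ψ` of the pure tube has `η ψ = 0`. [cite: Yang1989, eq. (6)] -/
theorem etaLowestWeight : ∀ (L M : ℕ) [NeZero L] [NeZero M], Even L → Even M → ∀ (Λ : Type) [LinearOrder Λ] [Fintype Λ] (e : Λ ≃ ZMod L × ZMod M) (U δ : ℝ), 0 < δ → 0 < tubePairCompressibility L M Λ e U δ → ∀ ψ : Fock (Orb Λ), IsGroundStateInSector (tubeH0 L M Λ e U) (tubeFilling L M δ) 0 ψ → etaLower (fun x => if ((e x).1.val + (e x).2.val) % 2 = 0 then (1 : ℤˣ) else -1) *ᵥ ψ = 0 :=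
  fun L M _ _ hL hM Λ _ _ e U _δ hδ hpos _ψ hgs =>
    etaLower_groundState_eq_zero L M Λ e _ (ite_stagger_bipartite L M Λ e hL hM) U hδ hpos hgs

end Summit.HubbardSuperconductivity.HubbardSuperconductivity.Theorems.WidthHaldane

end
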